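import Summits.Ventures.GridStability.Models.InverterDroop
import Summits.Ventures.GridStability.Models.InverterVSM
import Literature.MathematicalPhysics.PowerSystems.ClassicalSwingModel
import Literature.MathematicalPhysics.PowerSystems.DroopControlledInverters

/-!
# GridStability/Models/InverterBridges — droop ≡ VSM ≡ classical SMIB swing model (exact identities)

Cell `gridfusion` (LADDER-GRIDFUSION, rung G3 «inverter models», seat model-3). THREE COLUMNS: this
file is MODELLED-column bookkeeping between typed models; it proves IDENTITIES OF VECTOR FIELDS
(no approximation, no stability claim):

* §1 the reduced droop-controlled-converter-vs-infinite-bus model `InverterDroop.ReducedParams`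
  ([cite: Qoria2020, eq. (III-46) with (V-13)]) with `ω_set = ω_e`, read in the speed-deviation
  variable `Ω = ω_b (ω − ω_e)` [rad/s], IS the printed classical single-machine-infinite-bus swing
  model `Literature.MathematicalPhysics.PowerSystems.SMIB` ([cite: SauerPai1998, §9.6.2 eq. (9.30)])
  with `M = 1/(k_i ω_c)`, `D = 1/k_i`, `P_m = p*`, `P_e^max = P_max` — the content of
  [cite: SchifferEtAl2014, Remark 3.3] and [cite: Qoria2020, eqs. (III-21)–(III-22)]; hence the
  printed transient-energy computation `dV/dt = −D ω²` (`SMIB.hasDerivAt_energy`) transfers to the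
  droop inverter verbatim (§1, `hasDerivAt_energy`), and so does any certificate stated for `SMIB`.
* §2 the VSM outer loop `InverterVSM.VsmOuterLoop` ([cite: HenriquezAuba2022, eqs. (2.59a)–(2.59b)])
  closed with a quasi-static power–angle map IS an `InverterDroop.ReducedParams` with
  `k_i = Ω_b k_p`, `ω_c = 1/(M k_p)` (the Remark after (2.9) of [cite: HenriquezAuba2022], now as
  an identity of the closed two-state fields; solutions coincide).
* §3 the filter-less droop law `InverterDroop.ReducedParams.dδFirstOrder` is the printed
  frequency-droop law `Literature.MathematicalPhysics.PowerSystems.droopFrequency`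
  ([cite: SimpsonporcoDorflerBullo2013, eq. (Droop)]) with droop coefficient `n = k_i/ω_b`, scaled
  by `ω_b` and referred to the bus frequency.

Consequence recorded for the memo (§4/§5): an SOS/Lyapunov pipeline built for the classical SMIB
(rung G1.a) applies to the droop/VSM grid-forming inverter against an infinite bus with NO new
ingredient; per-unit conventions are absorbed by the parameter maps below.
-/

noncomputable section

open Real

namespace Summit.Ventures.GridStability.Models

open Literature.MathematicalPhysics.PowerSystems

/-! ## §1 Droop reduced model = classical SMIB swing model -/

namespace InverterDroop.ReducedParams

variable (P : InverterDroop.ReducedParams)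

/-- The classical SMIB parameter record equivalent to the reduced droop model in the speed-deviation
variable `Ω = ω_b(ω − ω_e)`: `M = 1/(k_i ω_c)`, `D = 1/k_i`, `P_m = p*`, `P_e^max = P_max`
([cite: Qoria2020, (III-21)–(III-22)]: `2H = ω_b/(ω_c k_i)` in per-unit speed, i.e. `M = 2H/ω_b`;
[cite: SchifferEtAl2014, Remark 3.3]). -/
def toSMIB : SMIB where
  M := 1 / (P.ki * P.ωc)
  D := 1 / P.ki
  Pm := P.pref
  Pmax := P.Pmax

/-- Pointwise identity of the frequency equations: the SMIB acceleration at `(δ, ω_b(ω − ω_e))`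
equals `ω_b` times the droop model's `dω` (for `ω_set = ω_e` and nonzero `ω_b, k_i, ω_c`). -/
theorem toSMIB_accel (hb : P.ωb ≠ 0) (hi : P.ki ≠ 0) (hc : P.ωc ≠ 0) (hω : P.ωset = P.ωe)
    (δ ω : ℝ) : P.toSMIB.accel δ (P.ωb * (ω - P.ωe)) = P.ωb * P.dω δ ω := by
  simp only [SMIB.accel, toSMIB, InverterDroop.ReducedParams.dω, InverterDroop.ReducedParams.dωOf, hω]
  field_simp

/-- **Solutions correspond.** If `(δ, ω)` solves the reduced droop model (with `ω_set = ω_e`), then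
`(δ, Ω)` with `Ω = ω_b(ω − ω_e)` solves the classical swing equations `δ̇ = Ω`,
`Ω̇ = (P_m − P_e^max sin δ − D Ω)/M` of `P.toSMIB`. -/
theorem isSolution_toSMIB (hb : P.ωb ≠ 0) (hi : P.ki ≠ 0) (hc : P.ωc ≠ 0) (hω : P.ωset = P.ωe)
    {δ ω : ℝ → ℝ} (h : P.IsSolution δ ω) (t : ℝ) :
    HasDerivAt δ (P.ωb * (ω t - P.ωe)) t ∧
    HasDerivAt (fun τ => P.ωb * (ω τ - P.ωe)) (P.toSMIB.accel (δ t) (P.ωb * (ω t - P.ωe))) t := by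
  refine ⟨?_, ?_⟩
  · simpa [InverterDroop.ReducedParams.dδ] using h.angle t
  · rw [P.toSMIB_accel hb hi hc hω]
    exact ((h.freq t).sub_const P.ωe).const_mul P.ωb

/-- **Printed energy computation, transferred.** Along every solution of the reduced droop model
(`ω_set = ω_e`), the Sauer–Pai transient energy `V(δ, Ω) = ½MΩ² − P_m(δ − δ_s) − P_e^max(cos δ − cos δ_s)`
of `P.toSMIB` satisfies `dV/dt = −(1/k_i) Ω²` [cite: SauerPai1998, §9.6.2 eq. (9.32)] — the droop
gain is the damping. MODELLED statement about the model; not an ROA claim. -/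
theorem hasDerivAt_energy (hb : P.ωb ≠ 0) (hi : P.ki ≠ 0) (hc : P.ωc ≠ 0) (hω : P.ωset = P.ωe)
    (δs : ℝ) {δ ω : ℝ → ℝ} (h : P.IsSolution δ ω) (t : ℝ) :
    HasDerivAt (fun τ => P.toSMIB.energy δs (δ τ, P.ωb * (ω τ - P.ωe)))
      (-(1 / P.ki * (P.ωb * (ω t - P.ωe)) ^ 2)) t := by
  have hM : P.toSMIB.M ≠ 0 := by
    simp only [toSMIB]
    exact one_div_ne_zero (mul_ne_zero hi hc)
  obtain ⟨hδ, hΩ⟩ := P.isSolution_toSMIB hb hi hc hω h t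
  have := P.toSMIB.hasDerivAt_energy hM δs (δ := δ) (ω := fun τ => P.ωb * (ω τ - P.ωe)) hδ hΩ
  simpa [toSMIB] using this

end InverterDroop.ReducedParams

/-! ## §2 VSM outer loop closed against an infinite bus = reduced droop model -/

namespace InverterVSM.VsmOuterLoop

variable (V : InverterVSM.VsmOuterLoop)

/-- The reduced droop parameters equivalent to the VSM (2.59a)–(2.59b) closed with `p_e = P_max sin θ`:
`ω_b := Ω_b`, `ω_c := 1/(M k_p)`, `k_i := Ω_b k_p`, `p* := p*`, `P_max`, `ω_set := ω*`, `ω_e := ω_s`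
([cite: HenriquezAuba2022], Remark after eq. (2.9): `M = 1/(ω_z k_p)`). -/
def toReduced (Pmax : ℝ) : InverterDroop.ReducedParams where
  ωb := V.Ωb
  ωc := 1 / (V.M * V.kp)
  ki := V.Ωb * V.kp
  pref := V.pref
  Pmax := Pmax
  ωset := V.ωref
  ωe := V.ωs

/-- Angle equations coincide. -/
theorem toReduced_dδ (Pmax θ ω : ℝ) : (V.toReduced Pmax).dδ θ ω = V.dθ ω := by
  simp [toReduced, InverterDroop.ReducedParams.dδ, InverterVSM.VsmOuterLoop.dθ]

/-- Frequency equations coincide (nonzero `Ω_b, M, k_p`). -/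
theorem toReduced_dω (hb : V.Ωb ≠ 0) (hM : V.M ≠ 0) (hk : V.kp ≠ 0) (Pmax θ ω : ℝ) :
    (V.toReduced Pmax).dω θ ω = V.dωClosed Pmax θ ω := by
  simp only [toReduced, InverterDroop.ReducedParams.dω, InverterDroop.ReducedParams.dωOf,
    InverterVSM.VsmOuterLoop.dωClosed, InverterVSM.VsmOuterLoop.dω]
  field_simp
  ring

/-- **Solutions coincide**: `(θ, ω)` solves the closed VSM model iff it solves the equivalent reduced
droop model. -/
theorem isSolution_iff_toReduced (hb : V.Ωb ≠ 0) (hM : V.M ≠ 0) (hk : V.kp ≠ 0) (Pmax : ℝ)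
    (θ ω : ℝ → ℝ) : V.IsSolution Pmax θ ω ↔ (V.toReduced Pmax).IsSolution θ ω := by
  constructor
  · intro h
    exact ⟨fun t => by simpa [V.toReduced_dδ] using h.angle t,
      fun t => by simpa [V.toReduced_dω hb hM hk] using h.freq t⟩
  · intro h
    exact ⟨fun t => by simpa [V.toReduced_dδ] using h.angle t,
      fun t => by simpa [V.toReduced_dω hb hM hk] using h.freq t⟩

end InverterVSM.VsmOuterLoop

/-! ## §3 Filter-less droop = the printed frequency-droop law -/

namespace InverterDroop.ReducedParams

variable (P : InverterDroop.ReducedParams)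

/-- The first-order droop angle equation is `ω_b` times (printed droop frequency − bus frequency):
`δ̇ = ω_b (droopFrequency ω_set (k_i/ω_b) p* (P_max sin δ) − ω_e)` with
`droopFrequency ω* n P* P_e = ω* − n (P_e − P*)` [cite: SimpsonporcoDorflerBullo2013, eq. (Droop)]. -/
theorem dδFirstOrder_eq_droopFrequency (hb : P.ωb ≠ 0) (δ : ℝ) :
    P.dδFirstOrder δ
      = P.ωb * (droopFrequency P.ωset (P.ki / P.ωb) P.pref (P.Pmax * sin δ) - P.ωe) := by
  simp only [InverterDroop.ReducedParams.dδFirstOrder, droopFrequency]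
  field_simp
  ring

end InverterDroop.ReducedParams

end Summit.Ventures.GridStability.Models

end
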